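import Mathlib.NumberTheory.Padics.PadicNumbers
import Mathlib.Topology.Algebra.InfiniteSum.Basic
import Mathlib.Analysis.SpecificLimits.Normed
import Literature.NumberTheory.EllipticCurves.PAdicHeights
import HarnessLib

/-!
# Coleman's `p`-adic polylogarithms `ℓ_n` on `ℚ_p` (Iwasawa branch) and the `p`-adic dilogarithm `D_p`

Coleman [Coleman1982, §VI] defines, for every branch of the `p`-adic logarithm, locally analytic
functions `ℓ_n : ℂ_p ∖ {1} → ℂ_p` ("multilogarithms", `Li_n` in later literature) by
`ℓ_0(z) = z/(1-z)`, `dℓ_n = ℓ_{n-1} dz/z`, `lim_{z→0} ℓ_n(z) = 0`; they are given by `∑ zᵏ/kⁿ` on the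
open unit disc and are continued to every residue class by "analytic continuation along Frobenius".
This file makes these functions available on `ℚ_p`-points for the **Iwasawa branch**
(`log_p p = 0`, `Literature.NumberTheory.EllipticCurves.padicLog`), as REAL definitions:

* `polylogSeries p n z = ∑_{k ≥ 1} zᵏ/kⁿ` (the naive series; converges for `‖z‖ < 1`);
* `regPolylogSum`, `regPolylog p n z` — Coleman's twisted function
  `ℓ_n^{(p)}(z) := ℓ_n(z) - p⁻ⁿ ℓ_n(zᵖ)`, computed by the Riemann sums of Koblitz' measure `μ_z`,
  `ℓ_n^{(p)}(z) = ∫_{ℤ_pˣ} x⁻ⁿ dμ_z = lim_N (1 - z^{p^N})⁻¹ ∑_{0<a<p^N, p∤a} zᵃ/aⁿ`, valid for `z ∉ B(1,1)`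
  [Coleman1982, Lemma 7.2; Besser2002, Prop. 2.1];
* `padicTeichmuller p z = lim_k z^{p^k}` (Teichmüller representative of a unit);
* `polylogAtOne p n = ℓ_n(1)` via Coleman's formula `lim_{x→1} ℓ_n(x) = (r^{1-n}-1)⁻¹ ∑_{ζʳ=1, ζ≠1} ℓ_n(ζ)`
  [Coleman1982, Cor. 7.1a] with `r = 2` (`p` odd) or `r = 3` (`p = 2`), and `ℓ_n(1) = 0` for even `n`;
* `discCoeff`, `nearOneCoeff`, `logPowCoeff` — Taylor coefficients of `ℓ_n` on the residue discs
  `|z - ζ| < 1` (`ζ ≠ 1` a `(p-1)`-st root of unity) and `|z - 1| < 1`;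
* `colemanPolylogarithm p n : ℚ_[p] → ℚ_[p]` — the function `ℓ_n` itself, by residue class:
  `‖z‖ < 1`: the series; `‖z‖ > 1`: inversion `ℓ_n(z) = -(-1)ⁿ ℓ_n(z⁻¹) - logⁿ(z)/n!`
  [Coleman1982, Prop. 6.4(i)]; `‖z-1‖ < 1`: `ℓ_n(z) = A_n(1-z) - log(1-z) log^{n-1}(z)/(n-1)!` with `A_n`
  the power series of `nearOneCoeff` (cf. [Coleman1982, Prop. 7.1]); `‖z‖ = ‖z-1‖ = 1`: the Taylor
  series at `ζ = padicTeichmuller p z` with constant terms `ℓ_m(ζ) = (1-p⁻ᵐ)⁻¹ ℓ_m^{(p)}(ζ)`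
  [Besser2002, Cor. 2.2 and Prop. 2.3] — exactly Coleman's characterisation "Frobenius fixes
  `ℓ_n(ζ)`, the differential equation fixes `ℓ_n` on the disc";
* `colemanD p z = ℓ_2(z) + ½ log_p(z) log_p(1-z)` — Coleman's `p`-adic dilogarithm `D`
  [Coleman1982, §VI p. 197; BesserDejeu2003, §1 p. 4], the function of route ABC/DilogDepthLaw.

Proved API: unfolding lemmas on `‖z‖ < 1` / `1 < ‖z‖`, `colemanPolylog_zero`, `colemanD_zero`, and
`colemanD_of_norm_lt_one` (= the requested "agreement with the series" for `v_p(z) ≥ 1`).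
The functional equations (inversion, `D(z) = -D(1-z) = -D(z⁻¹)`, Abel's five-term equation) are
NAMED FACTS in the sibling file `ColemanPolylogarithmFacts.lean` (kept out of this file so that
importing the definition does not enlarge a route's fact cone).

## Why these formulas are Coleman's functions (faithfulness notes for the reviewer)

Galois-equivariance of Coleman integration gives `ℓ_n(ℚ_p ∖ {1}) ⊆ ℚ_p` for the Iwasawa branch
[BesserDejeu2003, §1, Remark after (4)], so restricting to `ℚ_[p] → ℚ_[p]` loses nothing on
`ℚ_p`-points. On `‖z‖ < 1` the series is [Coleman1982, §VI, Taylor expansion p. 196]; on `‖z‖ > 1`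
inversion [Coleman1982, Prop. 6.4(i)] expresses `ℓ_n(z)` through the series at `z⁻¹`. On a residue
disc `|z-ζ| < 1`, `ζ^{p} = ζ ≠ 1`, `ℓ_n` is a convergent power series [Besser2002, p. 2 and Lemma 2.4]
whose constant term is forced by `ℓ_n(ζ) - p⁻ⁿℓ_n(ζᵖ) = ℓ_n^{(p)}(ζ)` [Besser2002, proof of Cor. 2.2] and
whose higher coefficients are forced by `d/du ℓ_{m+1}(ζ+u) = ℓ_m(ζ+u)/(ζ+u)` [Besser2002, proof of
Prop. 2.3]; `ℓ_n^{(p)}` is analytic off `B[1,|p|^{1/(p-1)}]` [Coleman1982, Prop. 6.2] and equals the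
measure integral there [Coleman1982, Lemma 7.2]. On `|z-1| < 1` one checks from `dℓ_n = ℓ_{n-1}dz/z`
that `A_n := ℓ_n + log(1-z)·log^{n-1}(z)/(n-1)!` satisfies `A_1 = 0`,
`dA_n/dw = -A_{n-1}/(1-w) + (log^{n-1}(1-w)/(n-1)!)/w` (`w = 1-z`), hence is a power series in `w` with
`A_n(0) = ℓ_n(1)` (`n ≥ 2`, [Coleman1982, Cor. 7.1a]); this is the recursion `nearOneCoeff`. The value
`ℓ_n(1)`: Coleman's `lim ℓ_n(x) = (r^{1-n}-1)⁻¹∑'_ζ ℓ_n(ζ)` with `∑'_ζ ℓ_n(ζ) = (1-p⁻ⁿ)⁻¹ ∑'_ζ ℓ_n^{(p)}(ζ)`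
(`ζ ↦ ζᵖ` permutes the non-trivial `r`-th roots of unity) and `∑'_ζ μ_ζ(a + p^Nℤ_p) =
∑'_ζ ζᵃ/(1-ζ^{p^N}) = c - (r+1)/2`, `c ∈ {1,…,r}`, `c ≡ p^N a (mod r)` for `r ∈ {2,3}` — a `ℚ`-valued
measure (`rootUnitySum`), which is how `p = 2` (no non-trivial roots of unity of odd order in `ℚ_2`)
is covered; for even `n`, `ℓ_n(1) = 0` by [Coleman1982, Prop. 6.4(i)] at `z → 1`. It equals
`pⁿ/(pⁿ-1) · L_p(n, ω^{1-n})` [Coleman1982, Introduction (4)] — NOT vendored here (no Kubota–Leopoldt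
`L_p` in Mathlib/Literature yet). NUMERICAL CHECK (folder `numerics/validate_coleman_polylog.py`):
with exactly these formulas, inversion (`n = 2..5`), the distribution relation `ℓ_n(z²) =
2^{n-1}(ℓ_n(z)+ℓ_n(-z))`, `D(z) = -D(1-z) = -D(z⁻¹)`, Abel's equation, `D(-1) = D(2) = D(½) = 0` and
the golden-ratio zeros of `D` hold across all residue classes for `p = 2,3,5,7,11` to the precision of
the Riemann sums (500+ identities).

## Junk values (documented)

`colemanPolylogarithm p 1 1 = -log_p 0 = 0` and `colemanPolylogarithm p 0 1 = 1/0 = 0` (true values: `∞`);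
`regPolylog`, `padicTeichmuller`, `polylogSeries` are `limUnder`/`tsum` junk outside their stated domains
(never used there by `colemanPolylogarithm`). `colemanD p 0 = colemanD p 1 = 0` agree with Coleman's
extension `D(0) = D(1) = D(∞) = 0` [Coleman1982, Cor. 6.4a].

## References

* [Coleman1982] R. F. Coleman, *Dilogarithms, regulators and `p`-adic `L`-functions*, Invent. Math.
  69 (1982) 171–208: §VI (i)–(iii) p. 195, Prop. 6.1, 6.2, 6.4, Cor. 6.4a, Cor. 6.5b, §VII Prop. 7.1,
  Cor. 7.1a, Lemma 7.2, Introduction (4).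
* [Besser2002] A. Besser, *Finite and `p`-adic polylogarithms*, Compositio Math. 130 (2002), §2.
* [BesserDejeu2003] A. Besser, R. de Jeu, *The syntomic regulator for the K-theory of fields*,
  Ann. Sci. ÉNS 36 (2003), §1 p. 4 (conventions, `D`, Galois equivariance).
* [Koblitz1984] N. Koblitz, *p-adic numbers, p-adic analysis, and zeta-functions*, ch. II (the
  measures `μ_z`).
* [Iwasawa1972PadicL] §4.4 (the branch `log_p p = 0`).
-/

noncomputable section

open scoped Classical
open Filter

namespace Literature.NumberTheory.PAdicPolylogarithms

open Literature.NumberTheory.EllipticCurves (padicLog)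

variable (p : ℕ) [Fact p.Prime]

/-! ### The naive series and Coleman's twisted function `ℓ_n^{(p)}` -/

/-- The polylogarithmic series `∑_{k ≥ 1} zᵏ / kⁿ` in `ℚ_p`, written as a `tsum` over `k : ℕ` of the
terms at `k + 1`. It converges exactly for `‖z‖ < 1`, where it is Coleman's `ℓ_n(z)`
[Coleman1982, §VI, p. 196]; elsewhere `tsum` returns junk. [cite: Coleman1982, §VI p. 196] -/
def polylogSeries (n : ℕ) (z : ℚ_[p]) : ℚ_[p] :=
  ∑' k : ℕ, z ^ (k + 1) / ((k : ℚ_[p]) + 1) ^ n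

/-- The `N`-th Riemann sum `(1 - z^{p^N})⁻¹ ∑_{0 < a < p^N, p ∤ a} zᵃ / aⁿ` of `∫_{ℤ_pˣ} x⁻ⁿ dμ_z(x)` for
Koblitz' measure `μ_z(a + p^N ℤ_p) = zᵃ/(1 - z^{p^N})` [Coleman1982, §VII p. 202; Besser2002,
Prop. 2.1]. [cite: Coleman1982, Lemma 7.2] -/
def regPolylogSum (n N : ℕ) (z : ℚ_[p]) : ℚ_[p] :=
  (1 - z ^ (p ^ N))⁻¹ *
    ∑ a ∈ (Finset.range (p ^ N)).filter (fun a => ¬ p ∣ a), z ^ a / (a : ℚ_[p]) ^ n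

/-- Coleman's twisted multilogarithm `ℓ_n^{(p)}(z) = ℓ_n(z) - p⁻ⁿ ℓ_n(zᵖ)`, which is rigid analytic on
`ℙ¹ ∖ B[1, |p|^{1/(p-1)}]` [Coleman1982, Prop. 6.2] and is given there by the measure integral
`∫_{ℤ_pˣ} x⁻ⁿ dμ_z(x)`, i.e. by the limit of `regPolylogSum p n N z` as `N → ∞`, for `z ∉ B(1,1)`
[Coleman1982, Lemma 7.2; Besser2002, Prop. 2.1]. Junk (`limUnder`) for `‖z - 1‖ < 1`.
[cite: Coleman1982, Lemma 7.2] -/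
def regPolylog (n : ℕ) (z : ℚ_[p]) : ℚ_[p] :=
  limUnder atTop (fun N : ℕ => regPolylogSum p n N z)

/-- The Teichmüller representative `ω(z) = lim_{k→∞} z^{p^k}` of a `p`-adic unit `z ∈ ℤ_pˣ`: the unique
`(p-1)`-st root of unity (`± 1` for `p = 2`) congruent to `z` modulo `p`. For `‖z‖ < 1` the limit is
`0`; for `‖z‖ > 1` it does not exist (junk). [folklore] -/
def padicTeichmuller (z : ℚ_[p]) : ℚ_[p] :=
  limUnder atTop (fun k : ℕ => z ^ (p ^ k))

/-! ### The values `ℓ_n(1)` -/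

/-- Auxiliary order of roots of unity used to evaluate `ℓ_n(1)`: `r = 3` for `p = 2`, `r = 2` for odd
`p` (any `r > 1` prime to `p` would do, [Coleman1982, Cor. 7.1a]). [folklore] -/
def auxRootOrder : ℕ := if p = 2 then 3 else 2

/-- For `r ∈ {2, 3}` and `x ≥ 1`: the rational number `c - (r+1)/2` where `c ∈ {1, …, r}`, `c ≡ x (mod r)`.
This is `∑_{ζʳ = 1, ζ ≠ 1} ζᵃ/(1 - ζᵐ)` whenever `gcd(m, r) = 1` and `x ≡ m⁻¹a ≡ m a (mod r)` (put
`η = ζᵐ`; then `∑_{η ≠ 1} ηᶜ/(1-η) = c - (r+1)/2` for `1 ≤ c ≤ r`), i.e. the total mass on `a + mℤ_p` of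
Koblitz' regularised measure `∑'_ζ μ_ζ` [Coleman1982, §VII (Koblitz' integral representation)].
[folklore] -/
def rootUnitySum (r x : ℕ) : ℚ :=
  (((x - 1) % r + 1 : ℕ) : ℚ) - ((r : ℚ) + 1) / 2

/-- The `N`-th Riemann sum of `∑_{ζʳ=1, ζ≠1} ∫_{ℤ_pˣ} x⁻ⁿ dμ_ζ`, `r = auxRootOrder p`, a rational
combination computing `∑'_ζ ℓ_n^{(p)}(ζ)` in the limit [Coleman1982, Lemma 7.2 and proof of (3),(4)].
[cite: Coleman1982, Lemma 7.2] -/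
def polylogAtOneSum (n N : ℕ) : ℚ_[p] :=
  ∑ a ∈ (Finset.range (p ^ N)).filter (fun a => ¬ p ∣ a),
    ((rootUnitySum (auxRootOrder p) (p ^ N * a) : ℚ) : ℚ_[p]) / (a : ℚ_[p]) ^ n

/-- The value `ℓ_n(1) := lim_{x → 1} ℓ_n(x)` (`n ≥ 2`; the limit over any finitely ramified extension
of `ℚ_p` exists, [Coleman1982, Cor. 7.1a]). By [Coleman1982, Cor. 7.1a],
`ℓ_n(1) = (r^{1-n} - 1)⁻¹ ∑_{ζʳ=1, ζ≠1} ℓ_n(ζ)` for every `r > 1`; with `r = auxRootOrder p` (prime to `p`)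
and `∑'_ζ ℓ_n(ζ) = (1 - p⁻ⁿ)⁻¹ ∑'_ζ ℓ_n^{(p)}(ζ)` (`ζ ↦ ζᵖ` permutes the non-trivial `r`-th roots of
unity; cf. [Besser2002, proof of Cor. 2.2]) this is the limit of `polylogAtOneSum`. For even `n`,
`ℓ_n(1) = 0` ([Coleman1982, Prop. 6.4(i)] at `z → 1`), which we take as the definition in that case;
for `n ≤ 1` the value is junk. It equals `pⁿ/(pⁿ-1) · L_p(n, ω^{1-n})` [Coleman1982, Introduction (4)].
[cite: Coleman1982, Cor. 7.1a] -/
def polylogAtOne (n : ℕ) : ℚ_[p] :=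
  if Even n then 0 else
    ((auxRootOrder p : ℚ_[p]) ^ (1 - (n : ℤ)) - 1)⁻¹ * (1 - (p : ℚ_[p]) ^ (-(n : ℤ)))⁻¹ *
      limUnder atTop (fun N : ℕ => polylogAtOneSum p n N)

/-! ### Taylor coefficients on the residue discs -/

/-- Taylor coefficients `c n k` of `ℓ_n` at a unit `ζ` with `ζᵖ = ζ ≠ 1` (a non-trivial `(p-1)`-st root
of unity): `ℓ_n(ζ + u) = ∑_k c n k · uᵏ` for `|u| < 1`. Level `0`: `z/(1-z) = -1 + ∑_k uᵏ/(1-ζ)^{k+1}`.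
Level `m+1`: constant term `ℓ_{m+1}(ζ) = (1 - p^{-(m+1)})⁻¹ ℓ_{m+1}^{(p)}(ζ)` (Frobenius,
[Besser2002, proof of Cor. 2.2] with `k = 1`), higher terms by integrating
`d/du ℓ_{m+1}(ζ+u) = ℓ_m(ζ+u) · (ζ+u)⁻¹ = (∑_i c m i uⁱ)(∑_j (-1)ʲ uʲ/ζ^{j+1})`
[Besser2002, proof of Prop. 2.3]. [cite: Besser2002, Prop. 2.3 (proof)] -/
def discCoeff (ζ : ℚ_[p]) : ℕ → ℕ → ℚ_[p]
  | 0 => fun k => ((1 - ζ) ^ (k + 1))⁻¹ - if k = 0 then 1 else 0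
  | m + 1 => fun k =>
      match k with
      | 0 => (1 - (p : ℚ_[p]) ^ (-((m : ℤ) + 1)))⁻¹ * regPolylog p (m + 1) ζ
      | k + 1 => ((k : ℚ_[p]) + 1)⁻¹ *
          ∑ i ∈ Finset.range (k + 1), discCoeff ζ m i * (-1) ^ (k - i) * (ζ ^ (k - i + 1))⁻¹

/-- The rational Taylor coefficients `λ m k` of `log^m(1 - w)/m! = ∑_k λ m k · wᵏ`:
`λ 0 = [k = 0]`, `λ (m+1) k = (m+1)⁻¹ ∑_{1 ≤ j ≤ k} (-1/j) λ m (k-j)` (Cauchy product with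
`log(1-w) = -∑_{j≥1} wʲ/j`). [folklore] -/
def logPowCoeff : ℕ → ℕ → ℚ
  | 0 => fun k => if k = 0 then 1 else 0
  | m + 1 => fun k => ((m : ℚ) + 1)⁻¹ *
      ∑ j ∈ Finset.range (k + 1), (if j = 0 then 0 else -(j : ℚ)⁻¹) * logPowCoeff m (k - j)

/-- Taylor coefficients `α n k` at `w = 0` of the analytic part `A_n(w) := ℓ_n(1-w) + log(w) ·
log^{n-1}(1-w)/(n-1)!` of `ℓ_n` on the residue disc of `1` (`w = 1 - z`; that `ℓ_n` is such a
power series plus a multiple of `log(1-z)` is [Coleman1982, Prop. 7.1] / [BesserEtAl2009, §4 (2)]).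
From `dℓ_n = ℓ_{n-1} dz/z`: `A_1 = 0`, `dA_n/dw = -A_{n-1}(w)/(1-w) + (log^{n-1}(1-w)/(n-1)!)/w`, so
`α n 0 = ℓ_n(1)` (`polylogAtOne`) and `(k+1) α n (k+1) = -∑_{i ≤ k} α (n-1) i + λ (n-1) (k+1)`.
Levels `0, 1` are the zero sequence (level `0` is never used). [cite: Coleman1982, Prop. 7.1] -/
def nearOneCoeff : ℕ → ℕ → ℚ_[p]
  | 0 => fun _ => 0
  | 1 => fun _ => 0
  | n + 2 => fun k =>
      match k with
      | 0 => polylogAtOne p (n + 2)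
      | k + 1 => ((k : ℚ_[p]) + 1)⁻¹ *
          (-(∑ i ∈ Finset.range (k + 1), nearOneCoeff (n + 1) i) +
            ((logPowCoeff (n + 1) (k + 1) : ℚ) : ℚ_[p]))

/-! ### Coleman's `ℓ_n` on `ℚ_p` and the dilogarithm `D` -/

/-- **Coleman's `p`-adic polylogarithm** `ℓ_n : ℚ_p → ℚ_p` (`Li_n` of [BesserDejeu2003]) for the Iwasawa
branch `log_p p = 0` of the logarithm [Coleman1982, §VI (i)–(iii): `ℓ_0 = z/(1-z)`,
`dℓ_n = ℓ_{n-1} dz/z`, `lim_{z→0} ℓ_n = 0`], restricted to `ℚ_p`-points (where it is `ℚ_p`-valued,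
[BesserDejeu2003, §1]). `ℓ_1(z) = -log_p(1-z)`. For `n ≥ 2`, by residue class of `z`:
`‖z‖ < 1`: `∑ zᵏ/kⁿ`; `‖z‖ > 1`: `-(-1)ⁿ ℓ_n(z⁻¹) - logⁿ_p(z)/n!` [Coleman1982, Prop. 6.4(i)];
`‖z - 1‖ < 1`: `∑_k α n k (1-z)ᵏ - log_p(1-z) log_p^{n-1}(z)/(n-1)!` (`nearOneCoeff`);
`‖z‖ = ‖z-1‖ = 1`: `∑_k c n k (z-ζ)ᵏ`, `ζ = padicTeichmuller p z` (`discCoeff`). Junk: `ℓ_0(1) = ℓ_1(1) = 0`.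
[cite: Coleman1982, §VI (i)-(iii) p. 195] -/
def colemanPolylogarithm : ℕ → ℚ_[p] → ℚ_[p]
  | 0, z => z / (1 - z)
  | 1, z => -padicLog p (1 - z)
  | n + 2, z =>
      if ‖z‖ < 1 then polylogSeries p (n + 2) z
      else if 1 < ‖z‖ then
        -(-1) ^ (n + 2) * polylogSeries p (n + 2) z⁻¹
          - padicLog p z ^ (n + 2) / ((n + 2).factorial : ℚ_[p])
      else if ‖z - 1‖ < 1 then
        (∑' k : ℕ, nearOneCoeff p (n + 2) k * (1 - z) ^ k)
          - padicLog p (1 - z) * padicLog p z ^ (n + 1) / ((n + 1).factorial : ℚ_[p])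
      else
        ∑' k : ℕ, discCoeff p (padicTeichmuller p z) (n + 2) k * (z - padicTeichmuller p z) ^ k

/-- **Coleman's `p`-adic dilogarithm** `D(z) = ℓ_2(z) + ½ log_p(z) log_p(1-z)` [Coleman1982, §VI
p. 197] (= `Li_2(z) - ½ log(z) Li_1(z)`, [BesserDejeu2003, §1 p. 4]; the `p`-adic analogue of the
Rogers/Bloch–Wigner function), here for the Iwasawa branch on `ℚ_p`. With `log_p 0 = 0` one has
`D(0) = D(1) = 0`, matching Coleman's extension of `D` to `ℙ¹` [Coleman1982, Cor. 6.4a].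
[cite: Coleman1982, §VI p. 197] -/
def colemanD (z : ℚ_[p]) : ℚ_[p] :=
  colemanPolylogarithm p 2 z + (1 / 2 : ℚ_[p]) * padicLog p z * padicLog p (1 - z)

/-! ### Unfolding lemmas -/

variable {p}

/-- `ℓ_0(z) = z/(1-z)` [Coleman1982, §VI (i)]. [cite: Coleman1982, §VI (i) p. 195] -/
@[simp] theorem colemanPolylog_zero_left (z : ℚ_[p]) : colemanPolylogarithm p 0 z = z / (1 - z) := rfl

/-- `ℓ_1(z) = -log_p(1-z)` [Coleman1982, §VII p. 201]. [cite: Coleman1982, §VII p. 201] -/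
@[simp] theorem colemanPolylog_one_left (z : ℚ_[p]) :
    colemanPolylogarithm p 1 z = -padicLog p (1 - z) := rfl

/-- On the open unit disc `ℓ_n` (`n ≥ 2`) is the series `∑ zᵏ/kⁿ` [Coleman1982, §VI p. 196].
[cite: Coleman1982, §VI p. 196] -/
theorem colemanPolylog_of_norm_lt_one (n : ℕ) {z : ℚ_[p]} (hz : ‖z‖ < 1) :
    colemanPolylogarithm p (n + 2) z = polylogSeries p (n + 2) z := by
  simp [colemanPolylogarithm, hz]

/-- Outside the closed unit disc `ℓ_n` (`n ≥ 2`) is given by inversion from the series at `z⁻¹`: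
`ℓ_n(z) = -(-1)ⁿ ∑ z⁻ᵏ/kⁿ - logⁿ_p(z)/n!` [Coleman1982, Prop. 6.4(i)]. [cite: Coleman1982, Prop. 6.4(i)] -/
theorem colemanPolylog_of_one_lt_norm (n : ℕ) {z : ℚ_[p]} (hz : 1 < ‖z‖) :
    colemanPolylogarithm p (n + 2) z =
      -(-1) ^ (n + 2) * polylogSeries p (n + 2) z⁻¹
        - padicLog p z ^ (n + 2) / ((n + 2).factorial : ℚ_[p]) := by
  have hz' : ¬ ‖z‖ < 1 := not_lt.mpr hz.le
  simp [colemanPolylogarithm, hz, hz']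

/-- On the residue disc of `1` (`‖z - 1‖ < 1`), `ℓ_n = A_n(1-z) - log_p(1-z) log_p^{n-1}(z)/(n-1)!`
with `A_n` the power series with coefficients `nearOneCoeff p n` (cf. [Coleman1982, Prop. 7.1]).
[cite: Coleman1982, Prop. 7.1] -/
theorem colemanPolylog_of_norm_sub_one_lt_one (n : ℕ) {z : ℚ_[p]} (hz : ‖z - 1‖ < 1) :
    colemanPolylogarithm p (n + 2) z =
      (∑' k : ℕ, nearOneCoeff p (n + 2) k * (1 - z) ^ k)
        - padicLog p (1 - z) * padicLog p z ^ (n + 1) / ((n + 1).factorial : ℚ_[p]) := by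
  have h1 : ‖z‖ = 1 := by
    have h := norm_sub_norm_le z 1
    have h' := norm_sub_norm_le 1 z
    rw [norm_sub_rev] at h'
    simp only [norm_one] at h h'
    -- ultrametric: ‖z‖ = ‖(z - 1) + 1‖ = 1 since ‖z - 1‖ < 1 = ‖1‖
    have key : ‖z - 1 + 1‖ = max ‖z - 1‖ ‖(1 : ℚ_[p])‖ :=
      IsUltrametricDist.norm_add_eq_max_of_norm_ne_norm (by rw [norm_one]; exact hz.ne)
    rw [sub_add_cancel, norm_one, max_eq_right hz.le] at key
    exact key
  have hlt : ¬ ‖z‖ < 1 := by rw [h1]; exact lt_irrefl 1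
  have hgt : ¬ 1 < ‖z‖ := by rw [h1]; exact lt_irrefl 1
  simp [colemanPolylogarithm, hlt, hgt, hz]

/-- On a residue disc `‖z‖ = ‖z - 1‖ = 1` (i.e. `|z - ζ| < 1` for the Teichmüller unit
`ζ = padicTeichmuller p z ≠ 1`), `ℓ_n` is its Taylor series at `ζ` with coefficients `discCoeff p ζ n`
[Besser2002, §2]. [cite: Besser2002, Prop. 2.3 (proof)] -/
theorem colemanPolylog_of_norm_eq_one (n : ℕ) {z : ℚ_[p]} (hz : ‖z‖ = 1) (hz1 : ‖z - 1‖ = 1) :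
    colemanPolylogarithm p (n + 2) z =
      ∑' k : ℕ, discCoeff p (padicTeichmuller p z) (n + 2) k * (z - padicTeichmuller p z) ^ k := by
  have hlt : ¬ ‖z‖ < 1 := by rw [hz]; exact lt_irrefl 1
  have hgt : ¬ 1 < ‖z‖ := by rw [hz]; exact lt_irrefl 1
  have h1 : ¬ ‖z - 1‖ < 1 := by rw [hz1]; exact lt_irrefl 1
  simp [colemanPolylogarithm, hlt, hgt, h1]

/-- The series vanishes at `0`. [folklore] -/
@[simp] theorem polylogSeries_zero (n : ℕ) : polylogSeries p n 0 = 0 := by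
  simp [polylogSeries]

/-- `ℓ_n(0) = 0` [Coleman1982, §VI (iii)]. [cite: Coleman1982, §VI (iii) p. 195] -/
@[simp] theorem colemanPolylog_zero (n : ℕ) : colemanPolylogarithm p n 0 = 0 := by
  match n with
  | 0 => simp
  | 1 =>
    -- `log_p 1 = (p-1)⁻¹ · L(1)` and every term of the series `L(1)` vanishes
    simp [Literature.NumberTheory.EllipticCurves.padicLog,
      Literature.NumberTheory.EllipticCurves.padicLogSeries]
  | n + 2 => simp [colemanPolylog_of_norm_lt_one]

/-- `D(0) = 0` [Coleman1982, Cor. 6.4a]. [cite: Coleman1982, Cor. 6.4a] -/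
@[simp] theorem colemanD_zero : colemanD p 0 = 0 := by
  simp [colemanD]

/-- **Agreement with the series** (the form used by route ABC/DilogDepthLaw): for `‖z‖ < 1`, i.e.
`v_p(z) ≥ 1`, `D(z) = ∑_{k≥1} zᵏ/k² + ½ log_p(z) log_p(1-z)` [Coleman1982, §VI p. 196–197].
[cite: Coleman1982, §VI p. 197] -/
theorem colemanD_of_norm_lt_one {z : ℚ_[p]} (hz : ‖z‖ < 1) :
    colemanD p z =
      (∑' k : ℕ, z ^ (k + 1) / ((k : ℚ_[p]) + 1) ^ 2)
        + (1 / 2 : ℚ_[p]) * padicLog p z * padicLog p (1 - z) := by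
  rw [colemanD, colemanPolylog_of_norm_lt_one 0 hz, polylogSeries]

/-- A rational number of `p`-adic valuation `≥ 1` lies in the open unit disc of `ℚ_p`. [folklore] -/
theorem norm_ratCast_lt_one_of_one_le_padicValRat {x : ℚ} (hx : x ≠ 0)
    (hv : 1 ≤ padicValRat p x) : ‖(x : ℚ_[p])‖ < 1 := by
  rw [Padic.eq_padicNorm, padicNorm.eq_zpow_of_nonzero hx]
  have hp : (1 : ℚ) < p := by exact_mod_cast (Fact.out : p.Prime).one_lt
  have h : ((p : ℚ) ^ (-padicValRat p x)) < 1 := zpow_lt_one_of_neg₀ hp (by linarith)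
  exact_mod_cast h

/-- **Agreement with the series on `p`-small rationals** (verbatim the left-hand side of
`Summit.ABC.ABC.Theses.DilogDepthLaw.DilogBilinearity`): for `x ∈ ℚ`, `x ≠ 0`, `v_p(x) ≥ 1`,
`D_p(x) = ∑_{n≥1} xⁿ/n² + ½ log_p(x) log_p(1-x)`. [cite: Coleman1982, §VI p. 197] -/
theorem colemanD_ratCast_of_one_le_padicValRat {x : ℚ} (hx : x ≠ 0) (hv : 1 ≤ padicValRat p x) :
    colemanD p x =
      (∑' n : ℕ, ((x : ℚ_[p]) ^ (n + 1)) / (((n : ℚ_[p]) + 1) ^ 2))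
        + (1 / 2 : ℚ_[p]) * padicLog p (x : ℚ_[p]) * padicLog p (1 - (x : ℚ_[p])) :=
  colemanD_of_norm_lt_one (norm_ratCast_lt_one_of_one_le_padicValRat hx hv)

end Literature.NumberTheory.PAdicPolylogarithms
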